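import Summits.CriticalPhenomena.PercolationContinuityZ3.Theorems.Transplant.SkelPhiFaceRunN
import HarnessLib

/-!
# N1 ({±1} node), (F) column slots (hp-8 g33): **THE FOUR CLOSED FORMS `k₀F / awF / kFF / mF`** of the face step and the inequalities they serve
# (`hk₀`, `haw`, `hroomF`, `hdiam` of `faceOblRM_fineNb`), generic in the fine frame `pr : FinePrm`, the cells `P` and the top kit level `Rlev`;
# each is the integer ceiling of the inequality it serves (lattice-only). stmt-g14 instantiates them at `NegB.prF` in the choice function of record.

builds on p205010 (kernel theorem, internal audit signed; external expert review pending) — nothing in this file uses p205010; no claim about the open node.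
Lane `prim-bschramm`, seat `prim-hp-8` (gen 33); helper file (`--supports stmt-CriticalPhenomena-4575 --as helper`).
* §1 `le_mul_cdiv` (`a ≤ b·⌈a/b⌉`), positivity `FinePrm.rdK_pos`, `Mabs_pos`; §2 defs **`FinePrm.k₀F`, `awF`, `kFF`, `mF`**;
  §3 **`FinePrm.hk₀_k₀F`, `haw_awF`, `hroomF_kFF`, `hdiam_mF`**, `k₀F_nonneg`.
[cite: KozmaNitzan2024, §4 Lemma 12 (pp. 23–25), p. 30] [cite: Timar2007, Lemma 2.2, p. 3]
-/

noncomputable section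

open scoped Classical

namespace Summit.CriticalPhenomena.PercolationContinuityZ3.Theorems.Transplant

open Literature.Probability.Percolation Literature.Probability.LatticeModels KNCells
open Literature.Probability.Percolation.KozmaNitzan
open Literature.Probability.Percolation.KozmaNitzan.Cells (oth oth_ne eq_oth_of_ne)
open TwoAxis.Para (modulus detD)

/-! ## §1 Integer ceilings -/

/-- The integer ceiling `⌈a/b⌉ := (a + b − 1)/b` serves `a ≤ b·⌈a/b⌉` (`0 < b`). [folklore] -/
theorem le_mul_cdiv {a b : ℤ} (hb : 0 < b) : a ≤ b * ((a + b - 1) / b) := by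
  have h1 := Int.mul_ediv_add_emod (a + b - 1) b
  have h2 := Int.emod_lt_of_pos (a + b - 1) hb
  linarith

/-- Monotonicity in the numerator of `b·⌈·/b⌉`-domination: `a' ≤ a ⟹ a' ≤ b·⌈a/b⌉`. [folklore] -/
theorem le_mul_cdiv_of_le {a a' b : ℤ} (hb : 0 < b) (h : a' ≤ a) : a' ≤ b * ((a + b - 1) / b) := h.trans (le_mul_cdiv hb)

namespace Skelφ

namespace FinePrm

variable (pr : FinePrm)

/-- `0 < rdK I (bOf I)` when the generator is nonzero and the resolutions are positive. [folklore] -/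
theorem rdK_pos (hc₀ : 0 < pr.c₀) (hc₁ : 0 < pr.c₁) (hDd : pr.D = detD pr.A pr.n pr.h pr.vα pr.vβ) (hD : 0 < pr.D) (I : Fin 2) :
    0 < pr.rdK I (pr.bOf I) := by
  unfold rdK
  exact mul_pos (pr.cOf_pos hc₀ hc₁ I) (abs_pos.2 (pr.lvGen_bOf_ne_zero I (pr.lvGen_ne_zero_of_detD_pos hDd hD I)))

/-- `0 < Mabs`. [folklore] -/
theorem Mabs_pos (hc₀ : 0 < pr.c₀) (hc₁ : 0 < pr.c₁) (hDd : pr.D = detD pr.A pr.n pr.h pr.vα pr.vβ) (hD : 0 < pr.D) : 0 < pr.Mabs := by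
  unfold Mabs
  exact mul_pos (mul_pos hc₀ hc₁) (abs_pos.2 (pr.A_mul_modulus_ne_zero hDd hD))

/-! ## §2 The four closed forms -/

/-- **`k₀`** — the transverse spill of one level line in a `3r`-wide strip: `max_I ⌈rdN I (bOf I) / rdK I (bOf I)⌉`. [this work] -/
def k₀F : ℤ :=
  max ((pr.rdN 0 (pr.bOf 0) + pr.rdK 0 (pr.bOf 0) - 1) / pr.rdK 0 (pr.bOf 0)) ((pr.rdN 1 (pr.bOf 1) + pr.rdK 1 (pr.bOf 1) - 1) / pr.rdK 1 (pr.bOf 1))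

/-- The `aw`-numerator at a direction. [this work] -/
def awNum (P : PCells2) (du : MDir) : ℤ :=
  (pr.rdK 1 (pr.bOf du.1) * (P.faceExt du 0 + 1) + pr.rdK 0 (pr.bOf du.1) * (P.faceExt du 1 + 1)) * pr.D

/-- **`aw`** — the raw half-width of the face's frame image: `max_du ⌈awNum du / Mabs⌉` (`awNum` depends on the axis `du.1` only). [this work] -/
def awF (P : PCells2) : ℤ :=
  max ((pr.awNum P ((0 : Fin 2), true) + pr.Mabs - 1) / pr.Mabs) ((pr.awNum P ((1 : Fin 2), true) + pr.Mabs - 1) / pr.Mabs)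

/-- The `kF`-numerator at a level axis. [this work] -/
def kFNum (P : PCells2) (Rlev : ℕ) (I : Fin 2) : ℤ := pr.Mabs * (pr.awF P + Rlev + 1) + pr.rdN I (pr.bOf I) * (Rlev + 2) * pr.D

/-- **`kF`** — the transverse cell half-width of the kit box: `max_I ⌈kFNum I / (rdK I (bOf I)·D)⌉`. [this work] -/
def kFF (P : PCells2) (Rlev : ℕ) : ℤ :=
  max ((pr.kFNum P Rlev 0 + pr.rdK 0 (pr.bOf 0) * pr.D - 1) / (pr.rdK 0 (pr.bOf 0) * pr.D))
    ((pr.kFNum P Rlev 1 + pr.rdK 1 (pr.bOf 1) * pr.D - 1) / (pr.rdK 1 (pr.bOf 1) * pr.D))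

/-- The `m`-numerator at a raw axis. [this work] -/
def mNum (P : PCells2) (b' : Fin 2) : ℤ := (pr.rdK 1 b' + pr.rdK 0 b') * (((50 * P.rmax : ℕ) : ℤ) + 1) * pr.D

/-- **`m`** — the planar diameter (raw units) of the `50·rmax`-cell window: `max_{b'} ⌈mNum b' / Mabs⌉`. [this work] -/
def mF (P : PCells2) : ℤ := max ((pr.mNum P 0 + pr.Mabs - 1) / pr.Mabs) ((pr.mNum P 1 + pr.Mabs - 1) / pr.Mabs)

/-! ## §3 The inequalities served -/

/-- `0 ≤ k₀F`. [folklore] -/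
theorem k₀F_nonneg (hc₀ : 0 < pr.c₀) (hc₁ : 0 < pr.c₁) (hDd : pr.D = detD pr.A pr.n pr.h pr.vα pr.vβ) (hD : 0 < pr.D) : 0 ≤ pr.k₀F := by
  unfold k₀F
  refine le_max_of_le_left (Int.ediv_nonneg ?_ (pr.rdK_pos hc₀ hc₁ hDd hD 0).le)
  have h1 : 0 ≤ pr.rdN 0 (pr.bOf 0) := by unfold rdN; exact mul_nonneg (pr.cOf_pos hc₀ hc₁ _).le (abs_nonneg _)
  linarith [pr.rdK_pos hc₀ hc₁ hDd hD 0]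

/-- **`hk₀`**: `rdN I (bOf I) ≤ rdK I (bOf I) · k₀F`. [this work] -/
theorem hk₀_k₀F (hc₀ : 0 < pr.c₀) (hc₁ : 0 < pr.c₁) (hDd : pr.D = detD pr.A pr.n pr.h pr.vα pr.vβ) (hD : 0 < pr.D) (I : Fin 2) :
    pr.rdN I (pr.bOf I) ≤ pr.rdK I (pr.bOf I) * pr.k₀F := by
  have hK := pr.rdK_pos hc₀ hc₁ hDd hD I
  have h1 := le_mul_cdiv (a := pr.rdN I (pr.bOf I)) hK
  refine h1.trans (mul_le_mul_of_nonneg_left ?_ hK.le)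
  unfold k₀F
  obtain rfl | rfl : I = 0 ∨ I = 1 := by fin_cases I <;> simp
  · exact le_max_left _ _
  · exact le_max_right _ _

/-- **`haw`**: `awNum du ≤ Mabs · (awF + 1)` (indeed `≤ Mabs · awF`). [this work] -/
theorem haw_awF (hc₀ : 0 < pr.c₀) (hc₁ : 0 < pr.c₁) (hDd : pr.D = detD pr.A pr.n pr.h pr.vα pr.vβ) (hD : 0 < pr.D) (P : PCells2) (du : MDir) :
    (pr.rdK 1 (pr.bOf du.1) * (P.faceExt du 0 + 1) + pr.rdK 0 (pr.bOf du.1) * (P.faceExt du 1 + 1)) * pr.D ≤ pr.Mabs * (pr.awF P + 1) := by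
  have hM := pr.Mabs_pos hc₀ hc₁ hDd hD
  have h1 := le_mul_cdiv (a := pr.awNum P du) hM
  have heq : pr.awNum P du = pr.awNum P (du.1, true) := rfl
  have hle : (pr.awNum P du + pr.Mabs - 1) / pr.Mabs ≤ pr.awF P := by
    rw [heq]
    unfold awF
    obtain ⟨a, e⟩ := du
    obtain rfl | rfl : a = 0 ∨ a = 1 := by fin_cases a <;> simp
    · exact le_max_left _ _
    · exact le_max_right _ _
  show pr.awNum P du ≤ _
  nlinarith

/-- **`hroomF`**: `Mabs·(awF + Rlev + 1) + rdN I (bOf I)·(Rlev+2)·D ≤ rdK I (bOf I) · kFF · D`. [this work] -/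
theorem hroomF_kFF (hc₀ : 0 < pr.c₀) (hc₁ : 0 < pr.c₁) (hDd : pr.D = detD pr.A pr.n pr.h pr.vα pr.vβ) (hD : 0 < pr.D) (P : PCells2) (Rlev : ℕ)
    (I : Fin 2) : pr.Mabs * (pr.awF P + Rlev + 1) + pr.rdN I (pr.bOf I) * (Rlev + 2) * pr.D ≤ pr.rdK I (pr.bOf I) * pr.kFF P Rlev * pr.D := by
  have hK := mul_pos (pr.rdK_pos hc₀ hc₁ hDd hD I) hD
  have h1 := le_mul_cdiv (a := pr.kFNum P Rlev I) hK
  have hle : (pr.kFNum P Rlev I + pr.rdK I (pr.bOf I) * pr.D - 1) / (pr.rdK I (pr.bOf I) * pr.D) ≤ pr.kFF P Rlev := by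
    unfold kFF
    obtain rfl | rfl : I = 0 ∨ I = 1 := by fin_cases I <;> simp
    · exact le_max_left _ _
    · exact le_max_right _ _
  have : pr.kFNum P Rlev I ≤ pr.rdK I (pr.bOf I) * pr.D * pr.kFF P Rlev := h1.trans (mul_le_mul_of_nonneg_left hle hK.le)
  unfold kFNum at this
  linarith

/-- **`hdiam`**: `(rdK 1 b' + rdK 0 b')·(50·rmax + 1)·D ≤ Mabs · (mF + 1)`. [this work] -/
theorem hdiam_mF (hc₀ : 0 < pr.c₀) (hc₁ : 0 < pr.c₁) (hDd : pr.D = detD pr.A pr.n pr.h pr.vα pr.vβ) (hD : 0 < pr.D) (P : PCells2) (b' : Fin 2) :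
    (pr.rdK 1 b' + pr.rdK 0 b') * (((50 * P.rmax : ℕ) : ℤ) + 1) * pr.D ≤ pr.Mabs * (pr.mF P + 1) := by
  have hM := pr.Mabs_pos hc₀ hc₁ hDd hD
  have h1 := le_mul_cdiv (a := pr.mNum P b') hM
  have hle : (pr.mNum P b' + pr.Mabs - 1) / pr.Mabs ≤ pr.mF P := by
    unfold mF
    obtain rfl | rfl : b' = 0 ∨ b' = 1 := by fin_cases b' <;> simp
    · exact le_max_left _ _
    · exact le_max_right _ _
  show pr.mNum P b' ≤ _
  nlinarith

end FinePrm

end Skelφ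

end Summit.CriticalPhenomena.PercolationContinuityZ3.Theorems.Transplant

end
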